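import Summits.QuantumFields.YangMills.Theorems.ParabolicTrajectoryContinuumLimitOnTrajectoryDefsD
import Literature.MathematicalPhysics.QuantumFieldTheory.MassGapFromLatticeClustering

/-!
# Route `ParabolicTrajectory`, crux `ContinuumLimitOnTrajectory` (stmt-QuantumFields-10522): vocabulary of line `two-orbit-synchronisation`, part E (reshape v3.5, seat c3)

Fifth route-posited vocabulary file of the line (lead `prover-line-stmt-QuantumFields-10522-c3-0`, seat c3; same
namespace as `…Defs`/`…DefsB`/`…DefsC`/`…DefsD`). Two cross-crux findings of the lead of stmt-QuantumFields-15828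
(`ContinuumLegGivenGap`, evidence notes on stmt-QuantumFields-10522 of 2026-08-16T22:38Z and 2026-08-17T00:01Z) force and
enable reshape v3.5 of the two physics inputs of v3.4 (`…DefsD`):
* the slack-free torus OS gap `TorusOSGap` — the last conjunct of `IRPhysics` (and of v3.3's `IRInputs`) — is UNSATISFIABLE
  on periodic tori (explicit OS-null two-slice witness: backward term `e^{−E₁L}` against OS variance `e^{−E₁N}`), so an
  input carrying it is not an honest input;
* route ParabolicTrajectory's E4 input `UCL r sch` is DERIVED (`ContinuumLegGivenGap.stub_uclOfCscl`, p132690) from the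
  ε-slack Cauchy–Schwarz clustering of the canonical scheme `SpeciesScheme.HasCSClustering r (canon r sch) Δ₁` (Literature
  `ClustersCS`, Lüscher's transfer-matrix currency, satisfiable) together with rotation restoration, `UUVB`, volume growth
  and `β_k → ∞`; and rotation restoration for ALL of `SO(4)` is DERIVED (`ContinuumLegGivenGap.stub_rotOfPythagorean`,
  p133709) from `UUVB` + asymptotic invariance under ONE Pythagorean rotation (Niven + closed angle subgroup + the landed
  axis symmetry).
Hence (nothing asserted in §1):
* §1 `Rot345 r sch` — asymptotic invariance of the canonical curvature distributions under the single rotation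
  `R e₀ = (3/5)e₀ − (4/5)e₁`, `R e₁ = (4/5)e₀ + (3/5)e₁`, `R e₂ = e₂`, `R e₃ = e₃` (verbatim the hypothesis of
  `stub_rotOfPythagorean`; a DISCRETE statement: `R` maps `ℤ⁴` into a commensurable lattice);
* §1 `IRPhysicsCS` — `IRPhysics` with `∃ Δ' > 0, TorusOSGap r sch Δ'` replaced by `∃ Δ₁ > 0, HasCSClustering r (canon r sch) Δ₁`
  (the currency from which the continuum gap clause `T.HasMassGap Δ₁` of the SAME canonical witness is read off:
  Literature `IsYangMillsFor.hasMassGap_of_hasCSClustering`);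
* §1 `UVPhysics345` — `UVPhysics` with `AsympRot` replaced by `Rot345`.
* §2 `ContinuumLimitWithGap` — (A) with `∃ Δ₁ > 0, T.HasMassGap Δ₁` for the same witness appended (the conclusion the
  line actually reaches from the CS input; implies the crux by name).
The useful directions (`Rot345 + UUVB ⇒ AsympRot`, `CSCL + … ⇒ UCL`) are the two landed sibling theorems; they are
applied in `…Reduction2`, which concludes `ContinuumLimitWithGap`, hence the crux BY NAME, from `ChartExists`,
`VolumeClause`, `IRPhysicsCS`, `UVPhysics345`.
Refs: line card `Lines/two-orbit-synchronisation.md`; `…DefsD`; Luscher1977; OsterwalderSeiler1978 §§2–4.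
-/

set_option autoImplicit false

open scoped SchwartzMap
open MeasureTheory Filter Topology
open Literature.MathematicalPhysics.QuantumFieldTheory Literature.MathematicalPhysics.QuantumLattice
open Literature.MathematicalPhysics.AQFT Literature.Probability.LatticeModels
open Summit.QuantumFields.YangMills.Theses.ParabolicTrajectory

noncomputable section

namespace Summit.QuantumFields.YangMills.Cruxes.ContinuumLimitOnTrajectory.TwoOrbitSynchronisation

section Vocabulary

variable {G : Type} [Group G] [TopologicalSpace G] [IsTopologicalGroup G] [CompactSpace G]
  [MeasurableSpace G] [BorelSpace G]

/-- **(ROT₃₄₅) asymptotic invariance under ONE Pythagorean rotation**: every linear isometry `R` of `ℝ⁴` with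
`R e₀ = (3/5)e₀ − (4/5)e₁`, `R e₁ = (4/5)e₀ + (3/5)e₁`, `R e₂ = e₂`, `R e₃ = e₃` changes the canonical curvature
distributions of off-diagonal test functions by `o(1)` as `k → ∞` (verbatim the hypothesis of
`ContinuumLegGivenGap.stub_rotOfPythagorean`, which upgrades it — with `UUVB` — to `AsympRot r sch`). -/
def Rot345 (r : LatticeRep G) (sch : SpeciesScheme (YMSpecies G)) : Prop :=
  ∀ R : (EuclideanSpace ℝ (Fin 4)) ≃ₗᵢ[ℝ] (EuclideanSpace ℝ (Fin 4)),
    R (EuclideanSpace.single 0 1) =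
      (3 / 5 : ℝ) • EuclideanSpace.single 0 1 + (-(4 / 5) : ℝ) • EuclideanSpace.single 1 1 →
    R (EuclideanSpace.single 1 1) =
      (4 / 5 : ℝ) • EuclideanSpace.single 0 1 + (3 / 5 : ℝ) • EuclideanSpace.single 1 1 →
    R (EuclideanSpace.single 2 1) = EuclideanSpace.single 2 1 →
    R (EuclideanSpace.single 3 1) = EuclideanSpace.single 3 1 →
    ∀ (p : ℕ) (F : 𝓢((Fin p → (EuclideanSpace ℝ (Fin 4))), ℂ)), IsOffDiagonal F →
      Tendsto (fun k : ℕ => curvDistribution r sch k p (linActMulti R F) - curvDistribution r sch k p F) atTop (𝓝 0)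

end Vocabulary

/-! ## §1 The v3.5 input statements -/

/-- **Stub statement — IR PHYSICS in Cauchy–Schwarz currency (open input; replaces `IRPhysics`).** Along every sequence of the
crux's hypothesis block with polynomial volume growth: the rate-free finite-size clause `QualFiniteSize r M sch n` and an
ε-slack Cauchy–Schwarz clustering of the CANONICAL scheme at some physical rate `Δ₁ > 0`,
`SpeciesScheme.HasCSClustering r (canon r sch) Δ₁` — Lüscher's transfer-matrix statement
`|⟨F̂Ω, (𝕋^{t/a} − |Ω⟩⟨Ω|)ĜΩ⟩| ≤ e^{−Δ₁t}‖F̂Ω‖‖ĜΩ‖ + ε` on slab-ordered real product tensors, eventually in `k`. It feeds the E4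
input `UCL` (`ContinuumLegGivenGap.stub_uclOfCscl`) and, for the same canonical witness, the continuum gap clause
(`IsYangMillsFor.hasMassGap_of_hasCSClustering`). (The slack-free `TorusOSGap` of `IRPhysics` is unsatisfiable on periodic
tori and is retired.) -/
def IRPhysicsCS : Prop :=
  ∀ (G : Type) [Group G] [TopologicalSpace G] [IsTopologicalGroup G] [CompactSpace G]
    [MeasurableSpace G] [BorelSpace G], IsCompactSimpleLieGroup G →
    ∀ (r : LatticeRep G) (M : ℕ) (θ Δ : ℝ) (sch : SpeciesScheme (YMSpecies G)) (n : ℕ → ℕ),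
    0 < θ → 0 < Δ → (∀ k, sch.a k = ((M : ℝ) ^ n k)⁻¹) → Tendsto sch.β atTop atTop →
    (∀ t : ℕ, 0 < t → ∃ c : ℝ, Tendsto (fun k => ((M : ℝ) ^ n k) ^ 8 *
      latticeConnectedCorr r.ρ (sch.β k) (sch.side k) r.curvature.F r.curvature.F (t * M ^ n k))
        atTop (𝓝 c)) →
    Tendsto (fun k => ((M : ℝ) ^ n k) ^ 8 *
      latticeConnectedCorr r.ρ (sch.β k) (sch.side k) r.curvature.F r.curvature.F (M ^ n k))
        atTop (𝓝 θ) →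
    HasLatticeMassGap r sch Δ → PolyVolumeGrowth sch →
      QualFiniteSize r M sch n ∧ ∃ Δ₁ : ℝ, 0 < Δ₁ ∧ SpeciesScheme.HasCSClustering r (canon r sch) Δ₁

/-- **Stub statement — UV PHYSICS with discrete rotation restoration (open input; replaces `UVPhysics`).** Along a
crux-admissible sequence with polynomial volume growth whose canonical curvature functions converge on products:
uniform-threshold plaquette-string bounds `UUVB`, asymptotic invariance under ONE Pythagorean rotation `Rot345`, and the two
non-degeneracy witnesses `ND2`, `ND3`. (`AsympRot` of `UVPhysics` follows: `ContinuumLegGivenGap.stub_rotOfPythagorean`.) -/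
def UVPhysics345 : Prop :=
  ∀ (G : Type) [Group G] [TopologicalSpace G] [IsTopologicalGroup G] [CompactSpace G]
    [MeasurableSpace G] [BorelSpace G], IsCompactSimpleLieGroup G →
    ∀ (r : LatticeRep G) (M : ℕ) (θ Δ : ℝ) (sch : SpeciesScheme (YMSpecies G)) (n : ℕ → ℕ),
    0 < θ → 0 < Δ → (∀ k, sch.a k = ((M : ℝ) ^ n k)⁻¹) → Tendsto sch.β atTop atTop →
    (∀ t : ℕ, 0 < t → ∃ c : ℝ, Tendsto (fun k => ((M : ℝ) ^ n k) ^ 8 *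
      latticeConnectedCorr r.ρ (sch.β k) (sch.side k) r.curvature.F r.curvature.F (t * M ^ n k))
        atTop (𝓝 c)) →
    Tendsto (fun k => ((M : ℝ) ^ n k) ^ 8 *
      latticeConnectedCorr r.ρ (sch.β k) (sch.side k) r.curvature.F r.curvature.F (M ^ n k))
        atTop (𝓝 θ) →
    HasLatticeMassGap r sch Δ → PolyVolumeGrowth sch → ConvProducts r sch →
      UUVB r sch ∧ Rot345 r sch ∧ ND2 r sch ∧ ND3 r sch


/-! ## §2 (A) with the continuum gap clause of the witness -/

/-- **`ContinuumLimitWithGap` — crux (A) with the continuum gap clause of the SAME witness appended**: under (A)'s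
hypothesis block the renormalised scheme `sch'` and OS data `T` of (A)'s conclusion exist AND `T.HasMassGap Δ₁` for some
`Δ₁ > 0`. A line statement (the conclusion of `…Reduction2.reductionCS` from `ChartExists`, `VolumeClause`, `IRPhysicsCS`,
`UVPhysics345`: the Cauchy–Schwarz clustering input that feeds E4 also delivers the gap of the canonical witness, i.e. the
transfer half of crux (B) for that witness); it implies the crux by name (`continuumLimitOnTrajectory_of_withGap`). -/
def ContinuumLimitWithGap : Prop :=
  ∀ (G : Type) [Group G] [TopologicalSpace G] [IsTopologicalGroup G] [CompactSpace G], IsCompactSimpleLieGroup G →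
    letI : MeasurableSpace G := borel G
    haveI : BorelSpace G := ⟨rfl⟩
    ∀ (r : LatticeRep G), ∃ M₀ : ℕ, ∀ M : ℕ, M₀ ≤ M → 2 ≤ M → ∃ θ₀ : ℝ, 0 < θ₀ ∧
      ∀ (θ Δ : ℝ) (sch : SpeciesScheme (YMSpecies G)) (n : ℕ → ℕ), 0 < θ → θ < θ₀ → 0 < Δ →
      (∀ k, sch.a k = ((M : ℝ) ^ n k)⁻¹) → Tendsto sch.β atTop atTop →
      (∀ t : ℕ, 0 < t → ∃ c : ℝ, Tendsto (fun k => ((M : ℝ) ^ n k) ^ 8 *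
        latticeConnectedCorr r.ρ (sch.β k) (sch.side k) r.curvature.F r.curvature.F (t * M ^ n k)) atTop (𝓝 c)) →
      Tendsto (fun k => ((M : ℝ) ^ n k) ^ 8 *
        latticeConnectedCorr r.ρ (sch.β k) (sch.side k) r.curvature.F r.curvature.F (M ^ n k)) atTop (𝓝 θ) →
      HasLatticeMassGap r sch Δ →
        ∃ sch' : SpeciesScheme (YMSpecies G), sch'.a = sch.a ∧ sch'.β = sch.β ∧ sch'.L = sch.L ∧
          ∃ T : OSData (YMSpecies G) 4, IsYangMillsFor r sch' T ∧ T.IsNontrivial r.curvature ∧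
            T.IsNonGaussian r.curvature ∧ ∃ Δ₁ : ℝ, 0 < Δ₁ ∧ T.HasMassGap Δ₁

/-! ## §3 Glue (proved): the strengthened statement implies the crux by name -/

/-- `ContinuumLimitWithGap` implies the crux `ContinuumLimitOnTrajectory` (drop the gap clause). Registered glue of
skeleton v3.5. -/
theorem continuumLimitOnTrajectory_of_withGap : ContinuumLimitWithGap → ContinuumLimitOnTrajectory := by
  intro h G _ _ _ _ hG
  letI : MeasurableSpace G := borel G
  haveI : BorelSpace G := ⟨rfl⟩
  intro r
  obtain ⟨M₀, hM₀⟩ := h G hG r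
  refine ⟨M₀, fun M hM h2 => ?_⟩
  obtain ⟨θ₀, hθ₀, hall⟩ := hM₀ M hM h2
  refine ⟨θ₀, hθ₀, fun θ Δ sch n hθ hθθ hΔ hshape hβ htower htune hgap => ?_⟩
  obtain ⟨sch', ha, hb, hL, T, hYM, hNT, hNG, -⟩ := hall θ Δ sch n hθ hθθ hΔ hshape hβ htower htune hgap
  exact ⟨sch', ha, hb, hL, T, hYM, hNT, hNG⟩

end Summit.QuantumFields.YangMills.Cruxes.ContinuumLimitOnTrajectory.TwoOrbitSynchronisation

end
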